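import Literature.Barriers.CriticalPhenomena.LaceExpansionIsingRandomWalkBound
import Mathlib.Analysis.Normed.Group.Tannery
import Mathlib.Analysis.SpecialFunctions.Pow.Asymptotics
import HarnessLib

/-!
# Sakai's lace expansion with diagrammatic bounds (Propositions 1.1 and 3.1 of Sakai 2007) as a
# named fact, and the PROOF that it yields `Sakai2007_isingAssumptionH`

Barrier catalogue `Literature/Barriers/CriticalPhenomena/` (D-0021), fifth file of the barrier
`LaceExpansionIsingAboveFour`, companion of `LaceExpansionIsingDeconvolution.lean` and
`LaceExpansionIsingRandomWalkBound.lean`. Those files reduce Sakai's Theorem 1.3 (spread-out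
Ising model, `d > 4`, `L ≫ 1`) to three named facts: Liu–Slade's Prop. 1.2 and Thm. 1.7 (pure
analysis) and `Sakai2007_isingAssumptionH` — Liu–Slade's Assumption 1.5 for the Ising family,
i.e. the INFINITE-VOLUME expansion `G_z = h_z + zD * h_z * G_z` with
`|h_z(x) - δ_{0,x}| ≤ K_h L^{-2+ε}(δ_{0,x} + o(1)⟦x⟧^{-(d+2+ρ)})`, `ρ = 2(d-4)`, under the bootstrap
hypothesis `b(z) ≤ 3`. In Sakai's paper that statement is assembled from two FINITE-VOLUME
results and a limiting procedure:

* **Proposition 1.1** (the expansion; §2, random-current representation; any coupling): for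
  `p ≥ 0`, `Λ ⊂ ℤ^d` finite, `j ≥ 0` there are `π^{(i)}_{p;Λ}(x)`, `R^{(j+1)}_{p;Λ}(x)` (`x ∈ Λ`) with
  `⟨φ_oφ_x⟩_{p;Λ} = Π^{(j)}(x) + Σ_{u,v} Π^{(j)}(u) τ_{u,v} ⟨φ_vφ_x⟩_{p;Λ} + (-1)^{j+1}R^{(j+1)}(x)`,
  `Π^{(j)} = Σ_{i≤j} (-1)^i π^{(i)}`, `τ_{u,v} = tanh(pJ_{u,v})` ((1.11)), and, ferromagnetically,
  `π^{(j)} ≥ δ_{j,0}δ_{o,x}`, `0 ≤ R^{(j+1)}(x) ≤ Σ_{u,v} π^{(j)}(u)τ_{u,v}⟨φ_vφ_x⟩_{p;Λ}` ((1.13));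
* **Proposition 3.1** (`x`-space bounds, spread-out model; §§4–5): if `τ ≤ 2` and
  `G(x) ≤ δ_{o,x} + θ₀⟦x⟧^{-q}` (`G = G_p` in infinite volume, `q ∈ (d/2, d)`, `⟦x⟧ = |x| ∨ 1`), then
  for `θ₀` small with `θ₀L^{d-q}` bounded away from zero, and any `Λ`,
  `π^{(i)}_Λ(x) ≤ O(θ₀)^i δ_{o,x} + O(θ₀³)⟦x⟧^{-3q}` (`i = 0, 1`), `π^{(i)}_Λ(x) ≤ O(θ₀)^i ⟦x⟧^{-3q}`
  (`i ≥ 2`), constants independent of `Λ` ((3.3));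

then (§3.1, sketch proof of Prop. 1.2, (3.4)–(3.6); §1.2, (1.18)) with `θ₀ = cL^{-2+ε}`, `q = d-2`:
`R^{(j)} → 0`, `|Π^{(j)}_Λ(x) - δ_{o,x}| ≤ O(θ₀)δ_{o,x} + O(θ₀²)⟦x⟧^{-3(d-2)}` uniformly in `Λ`, whence
a limit `Π_p = lim_Λ lim_j Π^{(j)}_{p;Λ}` with `G_p = Π_p + Π_p * τD * G_p`, which is Assumption 1.5
(`h_z = Π_p`, `z = τ`, `d + 2 + ρ = 3(d-2)`).

## What is formalised

* The two finite-volume statements as ONE named fact `Sakai2007_laceExpansionBounds`: the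
  objects `tauBond` (`τ_{u,v} = tanh β·1{u∼v}`), `boxPair` (`⟨φ_vφ_x⟩_{Λ_n}`, the tree's
  `isingTwoPoint … .free`), `lacePi` (`Π^{(j)}`); the predicates `IsLaceExpansion` ((1.11) ∧ (1.13)
  on the box `Λ_n`) and `LaceCoeffBounds` ((3.3) with `q = d - 2` and an explicit `O`-constant
  `C`); the fact = "for `d > 4`, `c₀ > 0` there are `θ₁, C, L₀` such that for `L ≥ L₀`,
  `θ₀ ∈ (0, θ₁]` with `θ₀L² ≥ c₀`, `β ≥ 0` with `τ ≤ 2` and `G_β ≤ δ + θ₀⟦·⟧^{-(d-2)}`, every box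
  carries `(π, R)` with `IsLaceExpansion ∧ LaceCoeffBounds C θ₀`" (Prop. 1.1 existentially —
  its formulas (2.15), (2.23), (2.37)–(2.38) are nested random-current expectations, not
  transcribed — and Prop. 3.1 of the same witnesses). Not proved: a theory (sixty pages).
* PROVED, the limiting procedure and the assembly (Parts 1–4):
  (1) `j → ∞` in finite volume: absolute convergence of `Σ_i (-1)^iπ^{(i)}_Λ` (`lacePiLim`),
  `R^{(j+1)}_Λ → 0` from (1.13) with `⟨φ_vφ_x⟩_Λ ≤ 1`, `Σ_vτ_{u,v} ≤ τ ≤ 2` ((3.5)), the `j = ∞`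
  identity `⟨φ_oφ_x⟩_Λ = Π_Λ(x) + Σ_{u,v∈Λ}Π_Λ(u)τ_{u,v}⟨φ_vφ_x⟩_Λ` and the uniform bound
  `|Π_Λ - δ| ≤ Cθ₀δ + (4C+8C²)θ₀²⟦x⟧^{-3(d-2)}` ((3.6)); (2) `Λ ↑ ℤ^d`: a pointwise convergent
  subsequence (Tychonoff for `∏_x[-B(x),B(x)]`, first countability), `⟨φ_vφ_x⟩_{Λ_n} → G_β(x-v)`
  (transport and volume monotonicity — "G(x-y) is an increasing limit of ⟨φ_yφ_x⟩_Λ", §5.1),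
  dominated convergence over `u ∈ ℤ^d` (Tannery), giving `G_β = Ψ + τ Ψ * (D * G_β)`;
  (3) the convolution algebra `Ψ * (D * G) = D * (Ψ * G)` (Liu–Slade's form `zD * h * G`) and the
  hyperoctahedral symmetrisation `h = |W|⁻¹Σ_σ Ψ∘σ` (the identity is linear in `Ψ` and covariant,
  the bounds convex and invariant), which supplies the `ℤ^d`-symmetry of `h_z` required by
  Assumption 1.5 without asserting it of the witnesses; (4) the constants: `θ₀ = 3K_S L^{-2+ε}`
  (so `b(z) ≤ 3` is (3.2), and `θ₀L² = 3K_S L^ε ≥ 3K_S = c₀`), `K_h = 3CK_S`,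
  `η_L = (4C+8C²)θ₀/C → 0`; whence `Sakai2007_isingAssumptionH_of_laceExpansionBounds`, and the
  corollaries `Sakai2007_thm13_spreadOut_of_LiuSlade_laceExpansionBounds` (Theorem 1.3 from
  Liu–Slade's two analysis facts and this fact) and `LaceExpansionIsingAboveFour_of_five_facts''`.

The source asserts the `Λ ↑ ℤ^d` limit along the full sequence ("there is a limit `Π_p`"); a
subsequential limit is what uniform bounds give and all that Assumption 1.5 (an existence
statement) needs, so nothing more is claimed.

On the status of Proposition 3.1: its printed proof rests on the diagrammatic bounds of
Sakai 2007, Prop. 4.1, in whose proof "we recently found a flaw … the directly affected are the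
proof of the bound on the 0th-order expansion coefficient … and [the key lemma]; the rest of that
paper is secure" (Sakai 2022, §1 and §2.5); Sakai 2022 proves "new diagrammatic bounds on the
expansion coefficients that are slightly more complicated than those in [Sakai 2007] but
nonetheless obey the same fast decay above the critical dimension" (Theorems 3.1, 3.4, 3.7, 3.11)
and re-derives from them the `x`-space decay (3.3) with `q = d - 2` "for sufficiently spread-out
(finite-variance) models in dimensions `d > 4`" (Lemma 3.2, Corollaries 3.3, 3.10, 3.14, printed
under the a priori bound (3.6) `‖τ‖₁ ∨ sup_{x≠o} G(x)/(θ⟦x⟧_L^{2-d}) ≤ 2`, `θ = O(L^{-2})`,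
`⟦x⟧_L = |x| ∨ L`), concluding that "the lace-expansion results for the Ising and `φ⁴` models so
far are all saved" (abstract). The fact below is Proposition 3.1 as printed in 2007 (hypothesis
(3.2)), specialised to `q = d - 2`, `d > 4`, boxes and `L ≥ L₀`, with this provenance recorded; it is
how Liu–Slade cite the result ("Assumption 1.5 has been verified for large `L` in [HHS03, Saka07]
with `ρ = 2(d-4)`", Liu–Slade 2026, §1.2.2).

## References

* A. Sakai, *Lace expansion for the Ising model*, Comm. Math. Phys. 272 (2007) 283–344,
  arXiv:math-ph/0510093: Proposition 1.1 with (1.11)–(1.13); §1.2 (`τ_{x,y} = tanh(pJ_{x,y})`,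
  `τ = Σ_x τ_{o,x}`, `D(x) = τ_{o,x}/τ`, (1.15), (1.18)); Proposition 3.1 with (3.2)–(3.3); §3.1
  ((3.4)–(3.6)); §5.1 (proof of Proposition 3.1; "G(x-y) is an increasing limit of ⟨φ_yφ_x⟩_Λ")
  [Sakai2007].
* A. Sakai, *Correct bounds on the Ising lace-expansion coefficients*, Comm. Math. Phys. 392
  (2022) 783–823, arXiv:2003.09856: abstract, §1, §2.4–2.5, Theorems 3.1/3.4/3.7/3.11, Lemma 3.2,
  Corollaries 3.3/3.10/3.14 [Sakai2022].
* Y. Liu, G. Slade, *Gaussian deconvolution and the lace expansion for spread-out models*,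
  arXiv:2310.07640, Assumption 1.5 with (1.17)–(1.18), §1.2.2 ((1.22)–(1.23)), Theorem 1.7
  [LiuSlade2026].
(Equation numbers are those of the arXiv versions held in the literature store, every display
counted: Prop. 1.1's displays are (1.11)–(1.13), Prop. 3.1's (3.2)–(3.3), the sketch proof of
Prop. 1.2 is (3.4)–(3.6).)
-/

noncomputable section

namespace Literature.Barriers.CriticalPhenomena.SpreadOutIsing

open Filter Finset Literature.Probability.LatticeModels
open scoped BigOperators Topology

variable {d L : ℕ}

/-! ## Objects -/

/-- Sakai's bond variable `τ_{u,v} = tanh(pJ_{u,v})` for the uniformly spread-out interaction in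
the normalisation of the barrier file (coupling `1` on the pairs `0 < ‖u - v‖_∞ ≤ L`, inverse
temperature `β = p/N_L`): `τ_{u,v} = tanh β · 1{u ∼ v}`.
[cite: Sakai2007, §1.2 (τ_{x,y} = tanh(pJ_{x,y})) and (1.15)] -/
def tauBond (d L : ℕ) (β : ℝ) (u v : Site d) : ℝ :=
  if (spreadOutGraph d L).Adj u v then Real.tanh β else 0

/-- The free-boundary finite-volume two-point function `⟨φ_vφ_x⟩_{p;Λ}` on the centred box
`Λ = Λ_n = {-n,…,n}^d` with general endpoints (the tree's `isingTwoPoint … .free v x`; for `v = 0`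
this is `boxTwoPoint`). [cite: Sakai2007, §1.1 (thermal average ⟨φ_xφ_y⟩_{p;Λ}) and (1.11)] -/
def boxPair (d L : ℕ) (β : ℝ) (n : ℕ) (v x : Site d) : ℝ :=
  isingTwoPoint (spreadOutGraph d L) (box d n) β 0 .free v x

/-- The alternating partial sums `Π^{(j)}(x) = Σ_{i=0}^{j} (-1)^i π^{(i)}(x)` of a sequence of
expansion coefficients. [cite: Sakai2007, (1.12)] -/
def lacePi (π : ℕ → Site d → ℝ) (j : ℕ) (x : Site d) : ℝ :=
  ∑ i ∈ Finset.range (j + 1), (-1 : ℝ) ^ i * π i x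

/-! ## The two printed statements as predicates -/

/-- **`(π, R)` is a lace expansion of the spread-out Ising two-point function on the box `Λ_n`
at inverse temperature `β`** — the content of Sakai 2007, Proposition 1.1 with the ferromagnetic
bounds (1.13), for the coefficients `π i = π^{(i)}_{p;Λ_n}` and remainders `R (j+1) = R^{(j+1)}_{p;Λ_n}`:
the identity (1.11) `⟨φ_oφ_x⟩_Λ = Π^{(j)}(x) + Σ_{u,v ∈ Λ} Π^{(j)}(u) τ_{u,v} ⟨φ_vφ_x⟩_Λ + (-1)^{j+1} R^{(j+1)}(x)`
for every `j ≥ 0` and `x ∈ Λ`, and `π^{(j)}(x) ≥ δ_{j,0}δ_{o,x}`,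
`0 ≤ R^{(j+1)}(x) ≤ Σ_{u,v ∈ Λ} π^{(j)}(u) τ_{u,v} ⟨φ_vφ_x⟩_Λ` (`x ∈ Λ`). The values of `π`, `R` off
`Λ_n` and of `R 0` are not constrained. [cite: Sakai2007, Proposition 1.1, (1.11)–(1.13)] -/
structure IsLaceExpansion (d L : ℕ) (β : ℝ) (n : ℕ) (π R : ℕ → Site d → ℝ) : Prop where
  /-- the lace expansion identity (1.11), for every `j ≥ 0` and `x ∈ Λ_n` -/
  identity : ∀ j : ℕ, ∀ x ∈ box d n,
    boxTwoPoint d L β n x = lacePi π j x +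
      (∑ u ∈ box d n, ∑ v ∈ box d n, lacePi π j u * tauBond d L β u v * boxPair d L β n v x) +
      (-1 : ℝ) ^ (j + 1) * R (j + 1) x
  /-- (1.13), first bound: `π^{(j)}(x) ≥ δ_{j,0} δ_{o,x}` -/
  pi_ge : ∀ j : ℕ, ∀ x ∈ box d n, (if j = 0 then delta0 x else 0) ≤ π j x
  /-- (1.13), second bound, lower half: `0 ≤ R^{(j+1)}(x)` -/
  R_nonneg : ∀ j : ℕ, ∀ x ∈ box d n, 0 ≤ R (j + 1) x
  /-- (1.13), second bound, upper half: `R^{(j+1)}(x) ≤ Σ_{u,v} π^{(j)}(u) τ_{u,v} ⟨φ_vφ_x⟩_Λ` -/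
  R_le : ∀ j : ℕ, ∀ x ∈ box d n,
    R (j + 1) x ≤ ∑ u ∈ box d n, ∑ v ∈ box d n, π j u * tauBond d L β u v * boxPair d L β n v x

/-- **The conclusion (3.3) of Sakai 2007, Proposition 3.1, with `q = d - 2` and an explicit
constant `C` for its `O(·)`**: on the box `Λ_n`,
`π^{(0)}(x) ≤ δ_{o,x} + Cθ₀³⟦x⟧^{-3(d-2)}`, `π^{(1)}(x) ≤ Cθ₀ δ_{o,x} + Cθ₀³⟦x⟧^{-3(d-2)}`, and
`π^{(i)}(x) ≤ (Cθ₀)^i ⟦x⟧^{-3(d-2)}` for `i ≥ 2` (`x ∈ Λ_n`; "`O(θ₀)^i`" is a geometric rate with an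
`i`-independent constant, as used in (3.5)). [cite: Sakai2007, Proposition 3.1, (3.3)] -/
structure LaceCoeffBounds (d : ℕ) (C θ₀ : ℝ) (n : ℕ) (π : ℕ → Site d → ℝ) : Prop where
  /-- `i = 0` -/
  pi_zero_le : ∀ x ∈ box d n,
    π 0 x ≤ delta0 x + C * θ₀ ^ 3 * jnorm x ^ (-(3 * ((d : ℝ) - 2)))
  /-- `i = 1` -/
  pi_one_le : ∀ x ∈ box d n,
    π 1 x ≤ C * θ₀ * delta0 x + C * θ₀ ^ 3 * jnorm x ^ (-(3 * ((d : ℝ) - 2)))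
  /-- `i ≥ 2` -/
  pi_le : ∀ i : ℕ, 2 ≤ i → ∀ x ∈ box d n, π i x ≤ (C * θ₀) ^ i * jnorm x ^ (-(3 * ((d : ℝ) - 2)))

/-! ## The named fact -/

/-- NAMED FACT — **Sakai 2007, Proposition 1.1 ∧ Proposition 3.1 for the uniformly spread-out
Ising model on centred boxes, `q = d - 2`, `d > 4`** (diagrammatic bounds as corrected in
Sakai 2022). Printed content. Prop. 1.1: "For any `p ≥ 0` and any `Λ ⊂ ℤ^d`, there exist
`π^{(j)}_{p;Λ}(x)` and `R^{(j+1)}_{p;Λ}(x)` for `x ∈ Λ` and `j ≥ 0` such that [(1.11)] … For the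
ferromagnetic case, we have the bounds [(1.13)]." Prop. 3.1: "Let `J_{o,x}` be the spread-out
interaction. Suppose that `τ ≤ 2`, `G(x) ≤ δ_{o,x} + θ₀⟦x⟧^{-q}` hold for some `θ₀ ∈ (0,∞)` and
`q ∈ (d/2, d)`. Then, for sufficiently small `θ₀` (with `θ₀L^{d-q}` being bounded away from zero)
and any `Λ ⊂ ℤ^d`, we have `π^{(i)}_Λ(x) ≤ O(θ₀)^i δ_{o,x} + O(θ₀³)⟦x⟧^{-3q}` (`i = 0, 1`),
`O(θ₀)^i ⟦x⟧^{-3q}` (`i ≥ 2`)", where "constants in the `O`-notation … are independent of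
`Λ ⊂ ℤ^d`", `G` is the infinite-volume two-point function ("`G(x-y)` is an increasing limit of
`⟨φ_yφ_x⟩_Λ`", §5.1) and `τ = Σ_x tanh(pJ_{o,x})`. Transcription: the uniformly spread-out `J` of
(1.15) in the normalisation of the barrier file (`τ_{u,v} = tauBond`, `τ = isingZ d L β = N_L tanh β`,
`G = spreadOutTwoPoint d L β`); `Λ` a centred box `Λ_n` (a special case of "any `Λ`"); `q = d - 2`
with `d > 4` (so `q ∈ (d/2, d)` and `θ₀L^{d-q} = θ₀L²`); "bounded away from zero" = a lower bound
`c₀ > 0` fixed before the smallness threshold `θ₁` and the constant `C`, which are uniform in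
`L`, `θ₀`, `p` and `Λ`; a largeness threshold `L ≥ L₀` is added (weakening the printed
statement to the regime `L ≫ 1` of Prop. 1.2 and of the 2022 re-derivation); Prop. 1.1 enters
existentially (its explicit formulas (2.15), (2.23),
(2.37)–(2.38) are not transcribed) and Prop. 3.1 is asserted of the same witnesses. On
provenance: the 2007 proof of Prop. 3.1 uses the diagrammatic bounds of Prop. 4.1, found flawed
and replaced by those of Sakai 2022 (Theorems 3.1, 3.4, 3.7, 3.11), from which Sakai 2022
re-derives (3.3) for `q = d - 2`, `d > 4`, `L ≫ 1` (Lemma 3.2, Corollaries 3.3, 3.10, 3.14, under the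
a priori bound (3.6) there) — "the lace-expansion results for the Ising and `φ⁴` models so far
are all saved"; the expansion itself (Prop. 1.1) is unaffected ("the rest of that paper is
secure", §2.5). A theory (random-current lace expansion, sixty pages), not proved here.
[cite: Sakai2007, Proposition 1.1 ((1.11)–(1.13)) and Proposition 3.1 ((3.2)–(3.3)), §5.1]
[cite: Sakai2022, abstract, §2.5, Theorems 3.1/3.4/3.7/3.11, Lemma 3.2, Corollaries 3.3/3.10/3.14]
[cite: LiuSlade2026, §1.2.2 ("Assumption 1.5 has been verified for large L in [HHS03, Saka07]")] -/
def Sakai2007_laceExpansionBounds : Prop :=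
  ∀ d : ℕ, 4 < d → ∀ c₀ : ℝ, 0 < c₀ → ∃ θ₁ : ℝ, 0 < θ₁ ∧ ∃ C : ℝ, 0 < C ∧ ∃ L₀ : ℕ, 1 ≤ L₀ ∧
    ∀ L : ℕ, L₀ ≤ L → ∀ θ₀ : ℝ, 0 < θ₀ → θ₀ ≤ θ₁ → c₀ ≤ θ₀ * (L : ℝ) ^ 2 →
      ∀ β : ℝ, 0 ≤ β → isingZ d L β ≤ 2 →
        (∀ x : Site d, spreadOutTwoPoint d L β x ≤ delta0 x + θ₀ * jnorm x ^ (-((d : ℝ) - 2))) →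
          ∀ n : ℕ, ∃ π R : ℕ → Site d → ℝ, IsLaceExpansion d L β n π R ∧ LaceCoeffBounds d C θ₀ n π

/-! ## Elementary finite-volume API -/

/-- `τ_{u,v} ≥ 0` for `β ≥ 0` (ferromagnetic case). [cite: Sakai2007, §2.2.3 ("τ_b … nonnegative")] -/
theorem tauBond_nonneg {β : ℝ} (hβ : 0 ≤ β) (u v : Site d) : 0 ≤ tauBond d L β u v := by
  unfold tauBond
  split_ifs
  · exact tanh_nonneg hβ
  · exact le_rfl

/-- `τ_{u,v} = τ D(v - u)` with `τ = N_L tanh β` and `D = soStep`. [cite: Sakai2007, §1.2 (D(x) = τ_{o,x}/τ)] -/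
theorem tauBond_eq_isingZ_mul_soStep (hd : 1 ≤ d) (hL : 1 ≤ L) (β : ℝ) (u v : Site d) :
    tauBond d L β u v = isingZ d L β * soStep d L (v - u) := by
  have hN : (soCount d L : ℝ) ≠ 0 := by exact_mod_cast (soCount_pos hd hL).ne'
  unfold tauBond isingZ soStep
  by_cases h : (spreadOutGraph d L).Adj u v
  · rw [if_pos h, if_pos ((spreadOutGraph_adj_iff_sub d L u v).1 h)]
    field_simp
  · rw [if_neg h, if_neg (fun h' => h ((spreadOutGraph_adj_iff_sub d L u v).2 h')), mul_zero]

/-- `τ_{u,v}` vanishes unless `v` is a neighbour of `u`. [folklore] -/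
theorem tauBond_of_not_adj {β : ℝ} {u v : Site d} (h : ¬(spreadOutGraph d L).Adj u v) :
    tauBond d L β u v = 0 := if_neg h

/-- `Σ_{v ∈ Λ} τ_{u,v} ≤ τ = N_L tanh β` for `β ≥ 0`. [cite: Sakai2007, (3.5) (Σ_v τ_{u,v} ≤ τ)] -/
theorem sum_tauBond_le_isingZ {β : ℝ} (hβ : 0 ≤ β) (Λ : Finset (Site d)) (u : Site d) :
    ∑ v ∈ Λ, tauBond d L β u v ≤ isingZ d L β := by
  classical
  calc ∑ v ∈ Λ, tauBond d L β u v
      ≤ ∑ v ∈ Λ ∪ (spreadOutGraph d L).neighborFinset u, tauBond d L β u v :=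
        Finset.sum_le_sum_of_subset_of_nonneg Finset.subset_union_left
          fun v _ _ => tauBond_nonneg hβ u v
    _ = ∑ v ∈ (spreadOutGraph d L).neighborFinset u, tauBond d L β u v := by
        refine (Finset.sum_subset Finset.subset_union_right fun v _ hv => ?_).symm
        exact tauBond_of_not_adj fun h => hv ((SimpleGraph.mem_neighborFinset _ _ _).2 h)
    _ = ∑ _v ∈ (spreadOutGraph d L).neighborFinset u, Real.tanh β :=
        Finset.sum_congr rfl fun v hv => if_pos ((SimpleGraph.mem_neighborFinset _ _ _).1 hv)
    _ = isingZ d L β := by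
        rw [Finset.sum_const, card_neighborFinset_spreadOutGraph, nsmul_eq_mul]
        rfl

/-- `|⟨φ_vφ_x⟩_Λ| ≤ 1`. [folklore] -/
theorem abs_boxPair_le_one (β : ℝ) (n : ℕ) (v x : Site d) : |boxPair d L β n v x| ≤ 1 :=
  abs_isingTwoPoint_le_one _ _ _ _ _ _ _

/-- `⟨φ_vφ_x⟩_Λ ≤ 1`. [folklore] -/
theorem boxPair_le_one (β : ℝ) (n : ℕ) (v x : Site d) : boxPair d L β n v x ≤ 1 :=
  (le_abs_self _).trans (abs_boxPair_le_one β n v x)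

/-- `⟨φ_0φ_x⟩_Λ` is `boxTwoPoint`. [folklore] -/
theorem boxPair_zero_left (β : ℝ) (n : ℕ) (x : Site d) : boxPair d L β n 0 x = boxTwoPoint d L β n x :=
  rfl

/-- `⟨φ_vφ_x⟩_{Λ_n} ≤ G_β(x - v)` for `v, x ∈ Λ_n`, `β ≥ 0` (translation and volume monotonicity).
[cite: Sakai2007, §5.1 ("G(x-y) is an increasing limit of ⟨φ_yφ_x⟩_Λ as Λ ↑ ℤ^d")] -/
theorem boxPair_le_spreadOutTwoPoint {β : ℝ} (hβ : 0 ≤ β) {n : ℕ} {v x : Site d}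
    (hv : v ∈ box d n) (hx : x ∈ box d n) :
    boxPair d L β n v x ≤ spreadOutTwoPoint d L β (x - v) :=
  isingTwoPoint_box_le_spreadOutTwoPoint hβ hv hx

/-- `⟨φ_vφ_x⟩_{Λ_n} ≥ ⟨φ_oφ_{x-v}⟩_{Λ_m}` once `Λ_m + v ⊆ Λ_n` contains `x`, i.e. for
`n ≥ m + ‖v‖_∞` and `x - v ∈ Λ_m` (transport by `v`, then volume monotonicity; `β ≥ 0`).
[cite: Sakai2007, §5.1 ("G(x-y) is an increasing limit of ⟨φ_yφ_x⟩_Λ as Λ ↑ ℤ^d")] -/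
theorem boxTwoPoint_le_boxPair {β : ℝ} (hβ : 0 ≤ β) {m n : ℕ} {v x : Site d}
    (hxv : x - v ∈ box d m) (hn : m + Site.supNorm v ≤ n) :
    boxTwoPoint d L β m (x - v) ≤ boxPair d L β n v x := by
  set φ := (Site.shift v).toEmbedding with hφ
  have hmap := isingTwoPoint_free_map (G := spreadOutGraph d L) (G' := spreadOutGraph d L) φ
    (Λ := box d m) (fun p _ q _ => spreadOutGraph_adj_shift_iff d L v p q) β 0 0 (x - v)
  have hφ0 : φ 0 = v := by simp [hφ]
  have hφx : φ (x - v) = x := by simp [hφ]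
  rw [hφ0, hφx] at hmap
  rw [boxTwoPoint, ← hmap]
  have hsub : (box d m).map φ ⊆ box d n :=
    (map_shift_box_subset m v).trans (box_mono d hn)
  have hvmem : v ∈ (box d m).map φ := hφ0 ▸ Finset.mem_map_of_mem φ (zero_mem_box d m)
  have hxmem : x ∈ (box d m).map φ := hφx ▸ Finset.mem_map_of_mem φ hxv
  exact isingTwoPoint_free_le_of_subset _ hβ hvmem hxmem hsub

/-- **The infinite-volume limit of the finite-volume two-point functions with general
endpoints**: `⟨φ_vφ_x⟩_{Λ_n} → G_β(x - v)` as `n → ∞` (`β ≥ 0`) — "the translation invariance of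
`G(x)` and the fact that `G(x-y)` is an increasing limit of `⟨φ_yφ_x⟩_Λ` as `Λ ↑ ℤ^d`".
[cite: Sakai2007, §5.1 (below (5.5))] -/
theorem tendsto_boxPair {β : ℝ} (hβ : 0 ≤ β) (v x : Site d) :
    Tendsto (fun n => boxPair d L β n v x) atTop (𝓝 (spreadOutTwoPoint d L β (x - v))) := by
  rw [Metric.tendsto_atTop]
  intro ε hε
  have hlim := tendsto_boxTwoPoint (d := d) (L := L) hβ (x - v)
  rw [Metric.tendsto_atTop] at hlim
  obtain ⟨m₀, hm₀⟩ := hlim ε hε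
  set m := max m₀ (Site.supNorm (x - v)) with hm
  refine ⟨m + Site.supNorm v + Site.supNorm x, fun n hn => ?_⟩
  have hxv : x - v ∈ box d m := mem_box_iff_supNorm_le.2 (le_max_right _ _)
  have hlow := boxTwoPoint_le_boxPair (d := d) (L := L) hβ hxv
    (show m + Site.supNorm v ≤ n by omega)
  have hv : v ∈ box d n := mem_box_iff_supNorm_le.2 (by omega)
  have hx : x ∈ box d n := mem_box_iff_supNorm_le.2 (by omega)
  have hup := boxPair_le_spreadOutTwoPoint (d := d) (L := L) hβ hv hx
  have hm₀' := hm₀ m (le_max_left _ _)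
  rw [Real.dist_eq, abs_sub_lt_iff] at hm₀' ⊢
  constructor <;> linarith


/-! ## Part 1. The limit `j → ∞` in finite volume ((3.5)–(3.6) of Sakai 2007) -/

section FiniteVolume

variable {β C θ₀ : ℝ} {n : ℕ} {π R : ℕ → Site d → ℝ}

/-- The decay profile `⟦x⟧^{-3(d-2)} = ⟦x⟧^{-(d+2+ρ)}`, `ρ = 2(d-4)`. [cite: Sakai2007, (3.6)] -/
def decay3 (d : ℕ) (x : Site d) : ℝ := jnorm x ^ (-(3 * ((d : ℝ) - 2)))

/-- `⟦x⟧^{-3(d-2)} > 0`. [folklore] -/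
theorem decay3_pos (x : Site d) : 0 < decay3 d x := Real.rpow_pos_of_pos (jnorm_pos x) _

/-- The coefficients of a ferromagnetic lace expansion are nonnegative on `Λ`. [cite: Sakai2007, (1.13)] -/
theorem IsLaceExpansion.pi_nonneg (hE : IsLaceExpansion d L β n π R) (i : ℕ) {x : Site d}
    (hx : x ∈ box d n) : 0 ≤ π i x := by
  have h := hE.pi_ge i x hx
  split_ifs at h
  · exact (delta0_nonneg x).trans h
  · exact h

/-- Termwise bound on the alternating series `Σ_i (-1)^i π^{(i)}(x) - δ_{o,x}` under (3.3) with
`Cθ₀ ≤ 1/2`, `θ₀ ≤ 1`: `|(-1)^i π^{(i)}(x) - δ_{i,0}δ_{o,x}| ≤ δ_{i,1} Cθ₀ δ_{o,x} + (2C + 4C²)θ₀² ⟦x⟧^{-3(d-2)} 2^{-i}`.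
[cite: Sakai2007, §3.1 ((3.6))] -/
theorem abs_laceTerm_sub_le (hE : IsLaceExpansion d L β n π R) (hB : LaceCoeffBounds d C θ₀ n π)
    (hC : 0 ≤ C) (hθ : 0 ≤ θ₀) (hθ1 : θ₀ ≤ 1) (hr : C * θ₀ ≤ 1 / 2) (i : ℕ) {x : Site d}
    (hx : x ∈ box d n) :
    |(-1 : ℝ) ^ i * π i x - (if i = 0 then delta0 x else 0)| ≤
      (if i = 1 then C * θ₀ * delta0 x else 0) +
        (2 * C + 4 * C ^ 2) * θ₀ ^ 2 * decay3 d x * (1 / 2) ^ i := by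
  have hJ : 0 < decay3 d x := decay3_pos x
  have hJ' := hJ.le
  have hπ0 := hE.pi_nonneg i hx
  have hθ32 : θ₀ ^ 3 ≤ θ₀ ^ 2 := by nlinarith
  have hCθ2 : 0 ≤ C * θ₀ ^ 2 * decay3 d x := by positivity
  rcases Nat.lt_or_ge i 2 with hi | hi
  · interval_cases i
    · -- `i = 0`: `0 ≤ π⁰ - δ ≤ Cθ₀³⟦x⟧^{-3(d-2)}`
      have hge := hE.pi_ge 0 x hx
      have hle := hB.pi_zero_le x hx
      simp only [pow_zero, one_mul, if_true, zero_ne_one, if_false, zero_add, mul_one] at hge ⊢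
      rw [abs_of_nonneg (by linarith)]
      calc π 0 x - delta0 x ≤ C * θ₀ ^ 3 * decay3 d x := by unfold decay3; linarith
        _ ≤ C * θ₀ ^ 2 * decay3 d x := by
            have := mul_le_mul_of_nonneg_right (mul_le_mul_of_nonneg_left hθ32 hC) hJ'
            exact this
        _ ≤ (2 * C + 4 * C ^ 2) * θ₀ ^ 2 * decay3 d x := by nlinarith
    · -- `i = 1`: `|{-π¹}| = π¹ ≤ Cθ₀δ + Cθ₀³⟦x⟧^{-3(d-2)}`
      have hle := hB.pi_one_le x hx
      simp only [pow_one, neg_one_mul, one_ne_zero, if_false, sub_zero, if_true, abs_neg]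
      rw [abs_of_nonneg hπ0]
      calc π 1 x ≤ C * θ₀ * delta0 x + C * θ₀ ^ 3 * decay3 d x := hle
        _ ≤ C * θ₀ * delta0 x + C * θ₀ ^ 2 * decay3 d x := by
            have := mul_le_mul_of_nonneg_right (mul_le_mul_of_nonneg_left hθ32 hC) hJ'
            linarith
        _ ≤ C * θ₀ * delta0 x + (2 * C + 4 * C ^ 2) * θ₀ ^ 2 * decay3 d x * (1 / 2) := by
            nlinarith
  · -- `i ≥ 2`: `πⁱ ≤ (Cθ₀)ⁱ⟦x⟧^{-3(d-2)} ≤ C²θ₀² 2^{-(i-2)} ⟦x⟧^{-3(d-2)}`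
    have hi0 : i ≠ 0 := by omega
    have hi1 : i ≠ 1 := by omega
    have hle := hB.pi_le i hi x hx
    simp only [hi0, if_false, sub_zero, hi1, zero_add]
    rw [abs_mul, abs_pow, abs_neg, abs_one, one_pow, one_mul, abs_of_nonneg hπ0]
    have hr0 : 0 ≤ C * θ₀ := by positivity
    obtain ⟨k, rfl⟩ : ∃ k, i = k + 2 := ⟨i - 2, by omega⟩
    have hpow : (C * θ₀) ^ (k + 2) ≤ (C * θ₀) ^ 2 * (1 / 2) ^ k := by
      rw [pow_add, mul_comm]
      exact mul_le_mul_of_nonneg_left (pow_le_pow_left₀ hr0 hr k) (pow_nonneg hr0 2)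
    have hhalf : (1 / 2 : ℝ) ^ k = 4 * (1 / 2) ^ (k + 2) := by rw [pow_add]; ring
    calc π (k + 2) x ≤ (C * θ₀) ^ (k + 2) * decay3 d x := hle
      _ ≤ (C * θ₀) ^ 2 * (1 / 2) ^ k * decay3 d x := mul_le_mul_of_nonneg_right hpow hJ'
      _ = 4 * C ^ 2 * θ₀ ^ 2 * decay3 d x * (1 / 2) ^ (k + 2) := by rw [hhalf]; ring
      _ ≤ (2 * C + 4 * C ^ 2) * θ₀ ^ 2 * decay3 d x * (1 / 2) ^ (k + 2) := by
          have : 0 ≤ θ₀ ^ 2 * decay3 d x * (1 / 2) ^ (k + 2) := by positivity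
          nlinarith

/-- The alternating series `Σ_i (-1)^i π^{(i)}(x)` converges absolutely under (3.3) with
`Cθ₀ ≤ 1/2`. [cite: Sakai2007, §1.2 ("there is a limit Π_p(x) ≡ lim lim Π^{(j)}")] -/
theorem summable_laceTerm (hE : IsLaceExpansion d L β n π R) (hB : LaceCoeffBounds d C θ₀ n π)
    (hC : 0 ≤ C) (hθ : 0 ≤ θ₀) (hθ1 : θ₀ ≤ 1) (hr : C * θ₀ ≤ 1 / 2) {x : Site d}
    (hx : x ∈ box d n) : Summable fun i : ℕ => (-1 : ℝ) ^ i * π i x := by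
  set K : ℝ := (2 * C + 4 * C ^ 2) * θ₀ ^ 2 * decay3 d x with hK
  have hg : Summable fun i : ℕ => (if i = 0 then delta0 x else 0) +
      ((if i = 1 then C * θ₀ * delta0 x else 0) + K * (1 / 2) ^ i) :=
    (hasSum_ite_eq 0 (delta0 x)).summable.add
      ((hasSum_ite_eq 1 (C * θ₀ * delta0 x)).summable.add
        ((summable_geometric_of_lt_one (by norm_num) (by norm_num)).mul_left K))
  refine Summable.of_norm_bounded hg fun i => ?_
  have h := abs_laceTerm_sub_le hE hB hC hθ hθ1 hr i hx
  rw [Real.norm_eq_abs]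
  have habs : |(-1 : ℝ) ^ i * π i x| ≤ |(-1 : ℝ) ^ i * π i x - (if i = 0 then delta0 x else 0)| +
      |(if i = 0 then delta0 x else (0 : ℝ))| := by
    have := abs_add_le ((-1 : ℝ) ^ i * π i x - (if i = 0 then delta0 x else 0))
      (if i = 0 then delta0 x else 0)
    rwa [sub_add_cancel] at this
  have hδ : |(if i = 0 then delta0 x else (0 : ℝ))| = (if i = 0 then delta0 x else 0) := by
    split_ifs
    · exact abs_of_nonneg (delta0_nonneg x)
    · exact abs_zero
  rw [hδ] at habs
  linarith

/-- The full alternating sum `Π_Λ(x) = Σ_{i ≥ 0} (-1)^i π^{(i)}_Λ(x)` (Sakai's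
`lim_{j↑∞} Π^{(j)}_{p;Λ}(x)`), set to `0` off `Λ`. [cite: Sakai2007, §1.2 (Π_p = lim_Λ lim_j Π^{(j)}_{p;Λ})] -/
def lacePiLim (d : ℕ) (n : ℕ) (π : ℕ → Site d → ℝ) (x : Site d) : ℝ :=
  if x ∈ box d n then ∑' i : ℕ, (-1 : ℝ) ^ i * π i x else 0

/-- `Π^{(j)}_Λ(x) → Π_Λ(x)` as `j → ∞` (`x ∈ Λ`). [cite: Sakai2007, §1.2 and §3.1] -/
theorem tendsto_lacePi (hE : IsLaceExpansion d L β n π R) (hB : LaceCoeffBounds d C θ₀ n π)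
    (hC : 0 ≤ C) (hθ : 0 ≤ θ₀) (hθ1 : θ₀ ≤ 1) (hr : C * θ₀ ≤ 1 / 2) {x : Site d}
    (hx : x ∈ box d n) :
    Tendsto (fun j => lacePi π j x) atTop (𝓝 (lacePiLim d n π x)) := by
  rw [lacePiLim, if_pos hx]
  have h := (summable_laceTerm hE hB hC hθ hθ1 hr hx).hasSum.tendsto_sum_nat
  exact h.comp (tendsto_add_atTop_nat 1)

/-- **(3.6) in finite volume**: `|Π^{(j)}_Λ(x) - δ_{o,x}| ≤ Cθ₀ δ_{o,x} + (4C + 8C²)θ₀²⟦x⟧^{-3(d-2)}`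
for every `j` (`x ∈ Λ`), under (3.3) with `Cθ₀ ≤ 1/2`, `θ₀ ≤ 1`. [cite: Sakai2007, (3.6)] -/
theorem abs_lacePi_sub_delta0_le (hE : IsLaceExpansion d L β n π R)
    (hB : LaceCoeffBounds d C θ₀ n π) (hC : 0 ≤ C) (hθ : 0 ≤ θ₀) (hθ1 : θ₀ ≤ 1)
    (hr : C * θ₀ ≤ 1 / 2) (j : ℕ) {x : Site d} (hx : x ∈ box d n) :
    |lacePi π j x - delta0 x| ≤
      C * θ₀ * delta0 x + (4 * C + 8 * C ^ 2) * θ₀ ^ 2 * decay3 d x := by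
  set K : ℝ := (2 * C + 4 * C ^ 2) * θ₀ ^ 2 * decay3 d x with hK
  have hK0 : 0 ≤ K := by have := (decay3_pos (d := d) x).le; positivity
  have hδsum : ∑ i ∈ Finset.range (j + 1), (if i = 0 then delta0 x else (0 : ℝ)) = delta0 x := by
    rw [Finset.sum_ite_eq']; simp
  have hrewrite : lacePi π j x - delta0 x =
      ∑ i ∈ Finset.range (j + 1), ((-1 : ℝ) ^ i * π i x - (if i = 0 then delta0 x else 0)) := by
    rw [Finset.sum_sub_distrib, hδsum]; rfl
  rw [hrewrite]
  refine (Finset.abs_sum_le_sum_abs _ _).trans ?_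
  refine (Finset.sum_le_sum fun i _ => abs_laceTerm_sub_le hE hB hC hθ hθ1 hr i hx).trans ?_
  rw [Finset.sum_add_distrib, Finset.sum_ite_eq', ← Finset.mul_sum]
  have hgeom := sum_geometric_two_le (j + 1)
  have h1 : (if (1 : ℕ) ∈ Finset.range (j + 1) then C * θ₀ * delta0 x else 0) ≤ C * θ₀ * delta0 x := by
    split_ifs
    · exact le_rfl
    · have := delta0_nonneg x; positivity
  have h2 : K * ∑ i ∈ Finset.range (j + 1), (1 / 2 : ℝ) ^ i ≤ K * 2 :=
    mul_le_mul_of_nonneg_left hgeom hK0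
  calc _ ≤ C * θ₀ * delta0 x + K * 2 := add_le_add h1 h2
    _ = C * θ₀ * delta0 x + (4 * C + 8 * C ^ 2) * θ₀ ^ 2 * decay3 d x := by rw [hK]; ring

/-- **(3.6) for the full sum**: `|Π_Λ(x) - δ_{o,x}| ≤ Cθ₀ δ_{o,x} + (4C + 8C²)θ₀²⟦x⟧^{-3(d-2)}` on `Λ`.
[cite: Sakai2007, (3.6)] -/
theorem abs_lacePiLim_sub_delta0_le (hE : IsLaceExpansion d L β n π R)
    (hB : LaceCoeffBounds d C θ₀ n π) (hC : 0 ≤ C) (hθ : 0 ≤ θ₀) (hθ1 : θ₀ ≤ 1)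
    (hr : C * θ₀ ≤ 1 / 2) {x : Site d} (hx : x ∈ box d n) :
    |lacePiLim d n π x - delta0 x| ≤
      C * θ₀ * delta0 x + (4 * C + 8 * C ^ 2) * θ₀ ^ 2 * decay3 d x := by
  have hlim := ((tendsto_lacePi hE hB hC hθ hθ1 hr hx).sub_const (delta0 x)).abs
  exact le_of_tendsto' hlim fun j => abs_lacePi_sub_delta0_le hE hB hC hθ hθ1 hr j hx

/-- `lacePiLim` vanishes off the box. [folklore] -/
theorem lacePiLim_of_not_mem {x : Site d} (hx : x ∉ box d n) : lacePiLim d n π x = 0 := if_neg hx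

/-- **The remainder vanishes**: `R^{(j+1)}_Λ(x) → 0` as `j → ∞` — from
`0 ≤ R^{(j+1)} ≤ Σ_{u,v} π^{(j)}(u)τ_{u,v}⟨φ_vφ_x⟩_Λ ≤ τ Σ_u π^{(j)}_Λ(u) = O(θ₀)^j` ((3.5), with
`⟨φ_vφ_x⟩_Λ ≤ 1` and `τ ≤ 2`). [cite: Sakai2007, (3.5)] -/
theorem tendsto_laceRemainder (hE : IsLaceExpansion d L β n π R) (hB : LaceCoeffBounds d C θ₀ n π)
    (hβ : 0 ≤ β) (hτ : isingZ d L β ≤ 2) (hC : 0 ≤ C) (hθ : 0 ≤ θ₀) (hr : C * θ₀ ≤ 1 / 2)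
    {x : Site d} (hx : x ∈ box d n) :
    Tendsto (fun j => (-1 : ℝ) ^ (j + 1) * R (j + 1) x) atTop (𝓝 0) := by
  set S : ℝ := ∑ u ∈ box d n, decay3 d u with hS
  have hS0 : 0 ≤ S := Finset.sum_nonneg fun u _ => (decay3_pos u).le
  have hr0 : 0 ≤ C * θ₀ := by positivity
  -- the geometric majorant
  have hmaj : Tendsto (fun j => 2 * S * (C * θ₀) ^ j) atTop (𝓝 0) := by
    have := (tendsto_pow_atTop_nhds_zero_of_lt_one hr0 (by linarith)).const_mul (2 * S)
    rw [mul_zero] at this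
    exact this
  refine squeeze_zero_norm' ?_ hmaj
  filter_upwards [Filter.eventually_ge_atTop 2] with j hj
  rw [norm_mul, norm_pow, norm_neg, norm_one, one_pow, one_mul, Real.norm_eq_abs,
    abs_of_nonneg (hE.R_nonneg j x hx)]
  calc R (j + 1) x
      ≤ ∑ u ∈ box d n, ∑ v ∈ box d n, π j u * tauBond d L β u v * boxPair d L β n v x :=
        hE.R_le j x hx
    _ ≤ ∑ u ∈ box d n, π j u * 2 := by
        refine Finset.sum_le_sum fun u hu => ?_
        have hπu := hE.pi_nonneg j hu
        calc ∑ v ∈ box d n, π j u * tauBond d L β u v * boxPair d L β n v x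
            ≤ ∑ v ∈ box d n, π j u * tauBond d L β u v := by
              refine Finset.sum_le_sum fun v _ => ?_
              have h1 := boxPair_le_one (d := d) (L := L) β n v x
              have h0 : 0 ≤ π j u * tauBond d L β u v := mul_nonneg hπu (tauBond_nonneg hβ u v)
              nlinarith
          _ = π j u * ∑ v ∈ box d n, tauBond d L β u v := by rw [Finset.mul_sum]
          _ ≤ π j u * 2 :=
              mul_le_mul_of_nonneg_left ((sum_tauBond_le_isingZ hβ _ u).trans hτ) hπu
    _ ≤ ∑ u ∈ box d n, (C * θ₀) ^ j * decay3 d u * 2 := by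
        refine Finset.sum_le_sum fun u hu => ?_
        exact mul_le_mul_of_nonneg_right (hB.pi_le j hj u hu) (by norm_num)
    _ = 2 * S * (C * θ₀) ^ j := by
        rw [hS, Finset.mul_sum, Finset.sum_mul]
        refine Finset.sum_congr rfl fun u _ => ?_
        ring

/-- **The lace expansion identity in finite volume after `j → ∞`**:
`⟨φ_oφ_x⟩_Λ = Π_Λ(x) + Σ_{u,v ∈ Λ} Π_Λ(u) τ_{u,v} ⟨φ_vφ_x⟩_Λ` (`x ∈ Λ`), `Π_Λ = lim_j Π^{(j)}_Λ`.
[cite: Sakai2007, (1.11) with (3.5) (R^{(j)} → 0)] -/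
theorem boxTwoPoint_eq_lacePiLim_add (hE : IsLaceExpansion d L β n π R)
    (hB : LaceCoeffBounds d C θ₀ n π) (hβ : 0 ≤ β) (hτ : isingZ d L β ≤ 2) (hC : 0 ≤ C)
    (hθ : 0 ≤ θ₀) (hθ1 : θ₀ ≤ 1) (hr : C * θ₀ ≤ 1 / 2) {x : Site d} (hx : x ∈ box d n) :
    boxTwoPoint d L β n x = lacePiLim d n π x +
      ∑ u ∈ box d n, ∑ v ∈ box d n, lacePiLim d n π u * tauBond d L β u v * boxPair d L β n v x := by
  set S : ℕ → ℝ := fun j =>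
    ∑ u ∈ box d n, ∑ v ∈ box d n, lacePi π j u * tauBond d L β u v * boxPair d L β n v x with hS
  have hSlim : Tendsto S atTop (𝓝 (∑ u ∈ box d n, ∑ v ∈ box d n,
      lacePiLim d n π u * tauBond d L β u v * boxPair d L β n v x)) := by
    refine tendsto_finsetSum _ fun u hu => tendsto_finsetSum _ fun v _ => ?_
    exact ((tendsto_lacePi hE hB hC hθ hθ1 hr hu).mul_const _).mul_const _
  have hlim : Tendsto (fun j => lacePi π j x + S j + (-1 : ℝ) ^ (j + 1) * R (j + 1) x) atTop
      (𝓝 (lacePiLim d n π x + (∑ u ∈ box d n, ∑ v ∈ box d n,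
        lacePiLim d n π u * tauBond d L β u v * boxPair d L β n v x) + 0)) :=
    ((tendsto_lacePi hE hB hC hθ hθ1 hr hx).add hSlim).add (tendsto_laceRemainder hE hB hβ hτ hC hθ hr hx)
  rw [add_zero] at hlim
  have hconst : Tendsto (fun _ : ℕ => boxTwoPoint d L β n x) atTop
      (𝓝 (boxTwoPoint d L β n x)) := tendsto_const_nhds
  have heq : (fun j => lacePi π j x + S j + (-1 : ℝ) ^ (j + 1) * R (j + 1) x) =
      fun _ : ℕ => boxTwoPoint d L β n x := by
    funext j
    exact (hE.identity j x hx).symm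
  rw [heq] at hlim
  exact tendsto_nhds_unique hconst hlim

end FiniteVolume


/-! ## Part 2. The limit `Λ ↑ ℤ^d` ((1.18) of Sakai 2007) -/

section InfiniteVolume

variable {β : ℝ}

/-- The inner bond sum `Σ_{v ∈ Λ_n} τ_{u,v} ⟨φ_vφ_x⟩_{Λ_n}` is at most `τ` in absolute value
(`β ≥ 0`). [cite: Sakai2007, (3.5)] -/
theorem abs_sum_tauBond_mul_boxPair_le (hβ : 0 ≤ β) (n : ℕ) (u x : Site d) :
    |∑ v ∈ box d n, tauBond d L β u v * boxPair d L β n v x| ≤ isingZ d L β := by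
  refine (Finset.abs_sum_le_sum_abs _ _).trans ?_
  refine le_trans (Finset.sum_le_sum fun v _ => ?_) (sum_tauBond_le_isingZ hβ (box d n) u)
  rw [abs_mul, abs_of_nonneg (tauBond_nonneg hβ u v)]
  exact mul_le_of_le_one_right (tauBond_nonneg hβ u v) (abs_boxPair_le_one β n v x)

/-- For `Λ_n ⊇` the neighbourhood of `u` (`n ≥ ‖u‖_∞ + L`), the inner bond sum is the sum over
the neighbours of `u`: `Σ_{v ∈ Λ_n} τ_{u,v}⟨φ_vφ_x⟩_{Λ_n} = Σ_{v ∼ u} tanh β ⟨φ_vφ_x⟩_{Λ_n}`. [folklore] -/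
theorem sum_tauBond_mul_boxPair_eq {n : ℕ} {u : Site d} (hn : Site.supNorm u + L ≤ n) (x : Site d) :
    ∑ v ∈ box d n, tauBond d L β u v * boxPair d L β n v x =
      ∑ v ∈ (spreadOutGraph d L).neighborFinset u, Real.tanh β * boxPair d L β n v x := by
  have hsub : (spreadOutGraph d L).neighborFinset u ⊆ box d n := fun v hv =>
    box_mono d hn (mem_box_add_of_adj (mem_box_iff_supNorm_le.2 le_rfl)
      ((SimpleGraph.mem_neighborFinset _ _ _).1 hv))
  rw [← Finset.sum_subset hsub]
  · refine Finset.sum_congr rfl fun v hv => ?_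
    rw [tauBond, if_pos ((SimpleGraph.mem_neighborFinset _ _ _).1 hv)]
  · intro v _ hv
    rw [tauBond_of_not_adj fun h => hv ((SimpleGraph.mem_neighborFinset _ _ _).2 h), zero_mul]

/-- **Limit of the inner bond sum**: `Σ_{v ∈ Λ_n} τ_{u,v}⟨φ_vφ_x⟩_{Λ_n} → Σ_{v ∼ u} tanh β G_β(x - v)`
as `n → ∞` (`β ≥ 0`). [cite: Sakai2007, §5.1 ("G(x-y) is an increasing limit of ⟨φ_yφ_x⟩_Λ")] -/
theorem tendsto_sum_tauBond_mul_boxPair (hβ : 0 ≤ β) (u x : Site d) :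
    Tendsto (fun n => ∑ v ∈ box d n, tauBond d L β u v * boxPair d L β n v x) atTop
      (𝓝 (∑ v ∈ (spreadOutGraph d L).neighborFinset u,
        Real.tanh β * spreadOutTwoPoint d L β (x - v))) := by
  have hlim : Tendsto (fun n => ∑ v ∈ (spreadOutGraph d L).neighborFinset u,
      Real.tanh β * boxPair d L β n v x) atTop (𝓝 (∑ v ∈ (spreadOutGraph d L).neighborFinset u,
        Real.tanh β * spreadOutTwoPoint d L β (x - v))) :=
    tendsto_finsetSum _ fun v _ => (tendsto_boxPair hβ v x).const_mul _
  refine hlim.congr' ?_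
  filter_upwards [Filter.eventually_ge_atTop (Site.supNorm u + L)] with n hn
  exact (sum_tauBond_mul_boxPair_eq hn x).symm

/-- The limit of the inner bond sum in convolution form:
`Σ_{v ∼ u} tanh β G_β(x - v) = τ (D * G_β)(x - u)` (`τ = N_L tanh β`, `D = soStep`).
[cite: Sakai2007, §1.2 (D(x) = τ_{o,x}/τ) and (1.18)] -/
theorem sum_neighbor_tanh_mul_eq (hd : 1 ≤ d) (hL : 1 ≤ L) (β : ℝ) (u x : Site d) :
    ∑ v ∈ (spreadOutGraph d L).neighborFinset u, Real.tanh β * spreadOutTwoPoint d L β (x - v) =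
      isingZ d L β * latticeConv (soStep d L) (spreadOutTwoPoint d L β) (x - u) := by
  have hN : (soCount d L : ℝ) ≠ 0 := by exact_mod_cast (soCount_pos hd hL).ne'
  -- the convolution is a finite sum over the neighbourhood of the origin
  have hconv : latticeConv (soStep d L) (spreadOutTwoPoint d L β) (x - u) =
      ∑ w ∈ (spreadOutGraph d L).neighborFinset 0,
        soStep d L w * spreadOutTwoPoint d L β (x - u - w) := by
    unfold latticeConv
    refine tsum_eq_sum fun w hw => ?_
    rw [soStep_of_not_adj fun h => hw ((SimpleGraph.mem_neighborFinset _ _ _).2 h), zero_mul]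
  rw [hconv, Finset.mul_sum]
  -- reindex the neighbourhood of `u` as the translate of the neighbourhood of `0`
  have hmap : (spreadOutGraph d L).neighborFinset u =
      ((spreadOutGraph d L).neighborFinset 0).map (Site.shift u).toEmbedding := by
    have := neighborFinset_add_eq_map (d := d) (L := L) 0 u
    rwa [zero_add] at this
  rw [hmap, Finset.sum_map]
  refine Finset.sum_congr rfl fun w hw => ?_
  have hadj : (spreadOutGraph d L).Adj 0 w := (SimpleGraph.mem_neighborFinset _ _ _).1 hw
  simp only [Equiv.coe_toEmbedding, Site.shift_apply]
  rw [soStep, if_pos hadj, isingZ, show x - (w + u) = x - u - w by abel]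
  field_simp

variable (d L β) in
/-- Hypotheses of the infinite-volume limit: a sequence `Φ_n` of functions supported on the
boxes `Λ_n` (the finite-volume sums `Π_{Λ_n} = lim_j Π^{(j)}_{Λ_n}`), uniformly dominated by a
summable function, each satisfying the `j → ∞` lace-expansion identity on its box.
[cite: Sakai2007, §1.2 ("Due to (1.17) uniformly in Λ ⊂ ℤ^d, there is a limit Π_p")] -/
structure IsBoxExpansionSeq (Φ : ℕ → Site d → ℝ) (B : Site d → ℝ) : Prop where
  /-- the dominating function is summable -/
  summable : Summable B
  /-- uniform domination -/
  dominated : ∀ n x, |Φ n x| ≤ B x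
  /-- support in the box -/
  eq_zero : ∀ n x, x ∉ box d n → Φ n x = 0
  /-- the identity `⟨φ_oφ_x⟩_{Λ_n} = Φ_n(x) + Σ_{u,v ∈ Λ_n} Φ_n(u) τ_{u,v} ⟨φ_vφ_x⟩_{Λ_n}` on `Λ_n` -/
  identity : ∀ n, ∀ x ∈ box d n, boxTwoPoint d L β n x = Φ n x +
    ∑ u ∈ box d n, ∑ v ∈ box d n, Φ n u * tauBond d L β u v * boxPair d L β n v x

/-- The double sum of the identity as a series over `ℤ^d`:
`Σ_{u,v ∈ Λ_n} Φ_n(u)τ_{u,v}⟨φ_vφ_x⟩ = Σ_{u ∈ ℤ^d} Φ_n(u) (Σ_{v ∈ Λ_n} τ_{u,v}⟨φ_vφ_x⟩)` (the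
summand vanishes off `Λ_n`). [folklore] -/
theorem IsBoxExpansionSeq.sum_eq_tsum {Φ : ℕ → Site d → ℝ} {B : Site d → ℝ}
    (h : IsBoxExpansionSeq d L β Φ B) (n : ℕ) (x : Site d) :
    ∑ u ∈ box d n, ∑ v ∈ box d n, Φ n u * tauBond d L β u v * boxPair d L β n v x =
      ∑' u : Site d, Φ n u * ∑ v ∈ box d n, tauBond d L β u v * boxPair d L β n v x := by
  rw [tsum_eq_sum (s := box d n)]
  · refine Finset.sum_congr rfl fun u _ => ?_
    rw [Finset.mul_sum]
    refine Finset.sum_congr rfl fun v _ => ?_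
    ring
  · intro u hu
    rw [h.eq_zero n u hu, zero_mul]

/-- **The infinite-volume limit** (Sakai 2007, §1.2: "Due to [the bounds] uniformly in
`Λ ⊂ ℤ^d`, there is a limit `Π_p(x)` … such that `G_p(x) = Π_p(x) + (Π_p * τD * G_p)(x)`"): from a
uniformly dominated sequence of box expansions one extracts (by compactness of
`∏_x [-B(x), B(x)]` and a diagonal subsequence) a limit `Ψ` satisfying the infinite-volume
identity `G_β(x) = Ψ(x) + τ Σ_u Ψ(u) (D * G_β)(x - u)`, i.e. `G = Ψ + τ Ψ * (D * G)`, together with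
every closed pointwise bound satisfied by the `Φ_n` on their boxes. (The source asserts the
limit along the full sequence; a subsequential limit is what the argument gives and all that
is used.) [cite: Sakai2007, §1.2, (1.18)] -/
theorem IsBoxExpansionSeq.exists_limit (hd : 1 ≤ d) (hL : 1 ≤ L) (hβ : 0 ≤ β)
    {Φ : ℕ → Site d → ℝ} {B : Site d → ℝ} (h : IsBoxExpansionSeq d L β Φ B)
    {b : Site d → ℝ} (hb : ∀ n, ∀ x ∈ box d n, |Φ n x - delta0 x| ≤ b x) :
    ∃ Ψ : Site d → ℝ, (∀ x, |Ψ x| ≤ B x) ∧ (∀ x, |Ψ x - delta0 x| ≤ b x) ∧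
      ∀ x, spreadOutTwoPoint d L β x = Ψ x + isingZ d L β *
        latticeConv Ψ (latticeConv (soStep d L) (spreadOutTwoPoint d L β)) x := by
  -- compactness: a subsequence converging pointwise
  set K : Set (Site d → ℝ) := Set.pi Set.univ fun x => Set.Icc (-B x) (B x) with hK
  have hKc : IsCompact K := isCompact_univ_pi fun x => isCompact_Icc
  have hmem : ∀ n, Φ n ∈ K := fun n => by
    simp only [hK, Set.mem_pi, Set.mem_univ, true_implies, Set.mem_Icc]
    exact fun x => abs_le.1 (h.dominated n x)
  obtain ⟨Ψ, hΨK, φ, hφ, hlimΦ⟩ := hKc.tendsto_subseq hmem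
  have hpt : ∀ x, Tendsto (fun k => Φ (φ k) x) atTop (𝓝 (Ψ x)) := fun x =>
    tendsto_pi_nhds.1 hlimΦ x
  have hφ' : Tendsto φ atTop atTop := hφ.tendsto_atTop
  have hΨB : ∀ x, |Ψ x| ≤ B x := fun x => by
    simp only [hK, Set.mem_pi, Set.mem_univ, true_implies, Set.mem_Icc] at hΨK
    exact abs_le.2 (hΨK x)
  -- eventually `x ∈ Λ_{φ k}`
  have hev : ∀ x : Site d, ∀ᶠ k in atTop, x ∈ box d (φ k) := fun x =>
    (hφ'.eventually (Filter.eventually_ge_atTop (Site.supNorm x))).mono fun k hk =>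
      mem_box_iff_supNorm_le.2 hk
  refine ⟨Ψ, hΨB, fun x => ?_, fun x => ?_⟩
  · -- closed pointwise bounds pass to the limit
    exact le_of_tendsto (((hpt x).sub_const (delta0 x)).abs)
      ((hev x).mono fun k hk => hb (φ k) x hk)
  · -- the identity: both sides converge along the subsequence
    set g : ℕ → Site d → ℝ := fun n u =>
      ∑ v ∈ box d n, tauBond d L β u v * boxPair d L β n v x with hg
    set gInf : Site d → ℝ := fun u =>
      ∑ v ∈ (spreadOutGraph d L).neighborFinset u, Real.tanh β * spreadOutTwoPoint d L β (x - v)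
      with hgInf
    have hτ0 : 0 ≤ isingZ d L β := mul_nonneg (Nat.cast_nonneg _) (tanh_nonneg hβ)
    -- dominated convergence for `Σ_u Φ_{φ k}(u) g_{φ k}(u)`
    have hdom : Tendsto (fun k => ∑' u, Φ (φ k) u * g (φ k) u) atTop
        (𝓝 (∑' u, Ψ u * gInf u)) := by
      refine tendsto_tsum_of_dominated_convergence (bound := fun u => B u * isingZ d L β)
        (h.summable.mul_right _) (fun u => ?_) (Filter.Eventually.of_forall fun k u => ?_)
      · exact (hpt u).mul ((tendsto_sum_tauBond_mul_boxPair hβ u x).comp hφ')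
      · rw [Real.norm_eq_abs, abs_mul]
        exact mul_le_mul (h.dominated (φ k) u) (abs_sum_tauBond_mul_boxPair_le hβ (φ k) u x)
          (abs_nonneg _) ((abs_nonneg _).trans (h.dominated (φ k) u))
    have hrhs : Tendsto (fun k => Φ (φ k) x + ∑' u, Φ (φ k) u * g (φ k) u) atTop
        (𝓝 (Ψ x + ∑' u, Ψ u * gInf u)) := (hpt x).add hdom
    have hlhs : Tendsto (fun k => boxTwoPoint d L β (φ k) x) atTop
        (𝓝 (spreadOutTwoPoint d L β x)) := (tendsto_boxTwoPoint hβ x).comp hφ'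
    have heq : ∀ᶠ k in atTop,
        boxTwoPoint d L β (φ k) x = Φ (φ k) x + ∑' u, Φ (φ k) u * g (φ k) u :=
      (hev x).mono fun k hk => by rw [h.identity (φ k) x hk, h.sum_eq_tsum]
    have hlim2 := hrhs.congr' (heq.mono fun k hk => hk.symm)
    have hGx := tendsto_nhds_unique hlhs hlim2
    rw [hGx]
    congr 1
    -- `Σ_u Ψ(u) gInf(u) = τ Σ_u Ψ(u) (D * G)(x - u)`
    simp only [hgInf, sum_neighbor_tanh_mul_eq hd hL β _ x]
    show ∑' u, Ψ u * (isingZ d L β * latticeConv (soStep d L) (spreadOutTwoPoint d L β) (x - u)) =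
      isingZ d L β * ∑' u, Ψ u * latticeConv (soStep d L) (spreadOutTwoPoint d L β) (x - u)
    rw [← tsum_mul_left]
    exact tsum_congr fun u => by ring

end InfiniteVolume


/-! ## Part 3. Convolution algebra and `ℤ^d`-symmetrisation -/

section Convolution

/-- Convolution with the finitely supported step distribution is a finite sum:
`(D * g)(x) = Σ_{w ∼ 0} D(w) g(x - w)`. [folklore] -/
theorem latticeConv_soStep_eq_sum (g : Site d → ℝ) (x : Site d) :
    latticeConv (soStep d L) g x =
      ∑ w ∈ (spreadOutGraph d L).neighborFinset 0, soStep d L w * g (x - w) := by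
  unfold latticeConv
  refine tsum_eq_sum fun w hw => ?_
  rw [soStep_of_not_adj fun h => hw ((SimpleGraph.mem_neighborFinset _ _ _).2 h), zero_mul]

/-- The summands of `(Ψ * G)(y)` are absolutely summable when `Ψ` is and `|G| ≤ 1`. [folklore] -/
theorem summable_mul_sub_of_abs_le_one {Ψ G : Site d → ℝ} (hΨ : Summable fun u => |Ψ u|)
    (hG : ∀ y, |G y| ≤ 1) (y : Site d) : Summable fun u => Ψ u * G (y - u) := by
  refine Summable.of_norm_bounded hΨ fun u => ?_
  rw [Real.norm_eq_abs, abs_mul]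
  exact mul_le_of_le_one_right (abs_nonneg _) (hG _)

/-- **`Ψ * (D * G) = D * (Ψ * G)`** for absolutely summable `Ψ`, `|G| ≤ 1` and the finitely
supported `D` (Fubini for a finite sum against an absolutely convergent series): Sakai's form
`Π_p * τD * G_p` of the convolution term equals Liu–Slade's `zD * h_z * G_z`.
[cite: Sakai2007, (1.18)] [cite: LiuSlade2026, (1.17)] -/
theorem latticeConv_latticeConv_soStep_comm {Ψ G : Site d → ℝ} (hΨ : Summable fun u => |Ψ u|)
    (hG : ∀ y, |G y| ≤ 1) (x : Site d) :
    latticeConv Ψ (latticeConv (soStep d L) G) x = latticeConv (soStep d L) (latticeConv Ψ G) x := by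
  have h1 : latticeConv Ψ (latticeConv (soStep d L) G) x = ∑' u, Ψ u *
      ∑ w ∈ (spreadOutGraph d L).neighborFinset 0, soStep d L w * G (x - u - w) :=
    tsum_congr fun u => by rw [latticeConv_soStep_eq_sum]
  rw [h1, latticeConv_soStep_eq_sum]
  unfold latticeConv
  simp only [Finset.mul_sum]
  rw [Summable.tsum_finsetSum]
  · refine Finset.sum_congr rfl fun w _ => ?_
    rw [← tsum_mul_left]
    refine tsum_congr fun u => ?_
    rw [sub_right_comm]
    ring
  · intro w _
    have h := (summable_mul_sub_of_abs_le_one hΨ hG (x - w)).mul_left (soStep d L w)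
    refine h.congr fun u => ?_
    rw [sub_right_comm]
    ring

end Convolution

section Symmetrise

/-- The hyperoctahedral data: a coordinate permutation and a sign vector, acting on `ℤ^d`
through `Site.signedPerm`. [folklore] -/
abbrev HOData (d : ℕ) : Type := Equiv.Perm (Fin d) × (Fin d → ℤˣ)

/-- The composition law of signed permutations on the data:
`σ_{g ⋆ h} = σ_g ∘ σ_h`. [folklore] -/
def hoComp (g h : HOData d) : HOData d := (g.1 * h.1, fun i => g.2 i * h.2 (g.1.symm i))

/-- `σ_{g ⋆ h} x = σ_g (σ_h x)`. [folklore] -/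
theorem signedPerm_hoComp (g h : HOData d) (x : Site d) :
    Site.signedPerm (hoComp g h).1 (hoComp g h).2 x =
      Site.signedPerm g.1 g.2 (Site.signedPerm h.1 h.2 x) := by
  funext i
  simp only [hoComp, Site.signedPerm_apply, Units.val_mul]
  rw [Equiv.Perm.mul_def, Equiv.symm_trans_apply]
  ring

/-- Right composition by fixed data is injective (hence bijective) on the finite type of data.
[folklore] -/
theorem hoComp_left_injective (h : HOData d) : Function.Injective fun g : HOData d => hoComp g h := by
  intro g g' hgg'
  simp only [hoComp, Prod.mk.injEq] at hgg'
  obtain ⟨h1, h2⟩ := hgg'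
  have h1' : g.1 = g'.1 := mul_right_cancel h1
  refine Prod.ext h1' (funext fun i => ?_)
  have := congrFun h2 i
  rw [h1'] at this
  exact mul_right_cancel this

/-- The hyperoctahedral average `f̄(x) = |W|⁻¹ Σ_{σ ∈ W} f(σx)` of a function on `ℤ^d`. [folklore] -/
def zdSymmetrize (f : Site d → ℝ) (x : Site d) : ℝ :=
  (Fintype.card (HOData d) : ℝ)⁻¹ * ∑ g : HOData d, f (Site.signedPerm g.1 g.2 x)

/-- The hyperoctahedral average is `ℤ^d`-symmetric. [folklore] -/
theorem isZdSymmetric_zdSymmetrize (f : Site d → ℝ) : IsZdSymmetric (zdSymmetrize f) := by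
  intro π ε x
  unfold zdSymmetrize
  congr 1
  set e : HOData d ≃ HOData d := Equiv.ofBijective (fun g : HOData d => hoComp g (π, ε))
    (hoComp_left_injective (π, ε)).bijective_of_finite with he
  conv_rhs => rw [← Equiv.sum_comp e]
  refine Finset.sum_congr rfl fun g _ => ?_
  rw [he, Equiv.ofBijective_apply, signedPerm_hoComp]

/-- The average of a symmetric function is the function. [folklore] -/
theorem zdSymmetrize_of_isZdSymmetric {f : Site d → ℝ} (hf : IsZdSymmetric f) (x : Site d) :
    zdSymmetrize f x = f x := by
  unfold zdSymmetrize
  rw [Finset.sum_congr rfl fun g _ => hf g.1 g.2 x, Finset.sum_const, Finset.card_univ,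
    nsmul_eq_mul, ← mul_assoc, inv_mul_cancel₀ (by positivity), one_mul]

/-- A symmetric pointwise bound around a symmetric centre passes to the average:
`|f - c| ≤ b` with `b, c` symmetric implies `|f̄ - c| ≤ b`. [folklore] -/
theorem abs_zdSymmetrize_sub_le {f c b : Site d → ℝ} (hc : IsZdSymmetric c) (hb : IsZdSymmetric b)
    (h : ∀ y, |f y - c y| ≤ b y) (x : Site d) : |zdSymmetrize f x - c x| ≤ b x := by
  have hN : (0 : ℝ) < Fintype.card (HOData d) := by positivity
  have hcx : c x = (Fintype.card (HOData d) : ℝ)⁻¹ * ∑ g : HOData d, c (Site.signedPerm g.1 g.2 x) :=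
    (zdSymmetrize_of_isZdSymmetric hc x).symm
  rw [hcx, zdSymmetrize, ← mul_sub, ← Finset.sum_sub_distrib, abs_mul, abs_of_pos (inv_pos.2 hN)]
  calc (Fintype.card (HOData d) : ℝ)⁻¹ * |∑ g : HOData d, (f (Site.signedPerm g.1 g.2 x) -
        c (Site.signedPerm g.1 g.2 x))|
      ≤ (Fintype.card (HOData d) : ℝ)⁻¹ * ∑ g : HOData d, b (Site.signedPerm g.1 g.2 x) := by
        refine mul_le_mul_of_nonneg_left ((Finset.abs_sum_le_sum_abs _ _).trans
          (Finset.sum_le_sum fun g _ => h _)) (inv_pos.2 hN).le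
    _ = b x := by rw [← zdSymmetrize, zdSymmetrize_of_isZdSymmetric hb]

/-- The average of an absolutely summable function is absolutely summable. [folklore] -/
theorem summable_abs_zdSymmetrize {f : Site d → ℝ} (hf : Summable fun u => |f u|) :
    Summable fun u => |zdSymmetrize f u| := by
  have hN : (0 : ℝ) ≤ (Fintype.card (HOData d) : ℝ)⁻¹ := by positivity
  have hg : ∀ g : HOData d, Summable fun u => |f (Site.signedPerm g.1 g.2 u)| := fun g =>
    (Equiv.summable_iff (Site.signedPerm g.1 g.2) (f := fun u => |f u|)).2 hf
  have hs : Summable fun u => (Fintype.card (HOData d) : ℝ)⁻¹ *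
      ∑ g : HOData d, |f (Site.signedPerm g.1 g.2 u)| :=
    (summable_sum fun g _ => hg g).mul_left _
  refine Summable.of_nonneg_of_le (fun u => abs_nonneg _) (fun u => ?_) hs
  rw [zdSymmetrize, abs_mul, abs_of_nonneg hN]
  exact mul_le_mul_of_nonneg_left (Finset.abs_sum_le_sum_abs _ _) hN

/-- `δ_{0,·}` is `ℤ^d`-symmetric. [folklore] -/
theorem isZdSymmetric_delta0 : IsZdSymmetric (delta0 (d := d)) := by
  intro π ε x
  simp only [delta0, signedPerm_eq_zero_iff]

/-- `|σx| = |x|`: signed coordinate permutations are Euclidean isometries. [folklore] -/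
theorem euclidNorm_signedPerm (π : Equiv.Perm (Fin d)) (ε : Fin d → ℤˣ) (x : Site d) :
    euclidNorm (Site.signedPerm π ε x) = euclidNorm x := by
  unfold euclidNorm
  congr 1
  have hterm : ∀ i, (((Site.signedPerm π ε x) i : ℤ) : ℝ) ^ 2 = ((x (π.symm i) : ℤ) : ℝ) ^ 2 := by
    intro i
    rw [Site.signedPerm_apply]
    push_cast
    rcases Int.units_eq_one_or (ε i) with h | h <;> simp [h]
  simp only [hterm]
  exact Equiv.sum_comp π.symm (fun j => ((x j : ℤ) : ℝ) ^ 2)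

/-- `⟦σx⟧ = ⟦x⟧`. [folklore] -/
theorem jnorm_signedPerm (π : Equiv.Perm (Fin d)) (ε : Fin d → ℤˣ) (x : Site d) :
    jnorm (Site.signedPerm π ε x) = jnorm x := by
  rw [jnorm, jnorm, euclidNorm_signedPerm]

/-- **Convolution against symmetric kernels commutes with the symmetries**: for `ℤ^d`-symmetric
`G` and the (symmetric) step distribution `D`,
`(D * ((Ψ ∘ σ) * G))(x) = (D * (Ψ * G))(σx)`. [folklore] -/
theorem latticeConv_comp_signedPerm {Ψ G : Site d → ℝ} (hG : IsZdSymmetric G)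
    (π : Equiv.Perm (Fin d)) (ε : Fin d → ℤˣ) (x : Site d) :
    latticeConv (soStep d L) (latticeConv (fun u => Ψ (Site.signedPerm π ε u)) G) x =
      latticeConv (soStep d L) (latticeConv Ψ G) (Site.signedPerm π ε x) := by
  set T := Site.signedPerm π ε with hT
  -- inner convolution: `((Ψ ∘ σ) * G)(y) = (Ψ * G)(σ y)`
  have hinner : ∀ y, latticeConv (fun u => Ψ (T u)) G y = latticeConv Ψ G (T y) := by
    intro y
    unfold latticeConv
    rw [← Equiv.tsum_eq T (fun u' => Ψ u' * G (T y - u'))]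
    refine tsum_congr fun u => ?_
    congr 1
    rw [← hG π ε (y - u), hT, signedPerm_sub]
  unfold latticeConv at hinner ⊢
  simp only [hinner]
  rw [← Equiv.tsum_eq T (fun w' => soStep d L w' * ∑' u, Ψ u * G (T x - w' - u))]
  refine tsum_congr fun w => ?_
  rw [hT, isZdSymmetric_soStep π ε w, signedPerm_sub]

variable {β : ℝ}

/-- **Symmetrisation of the infinite-volume expansion**: if `G_β = Ψ + τ D * (Ψ * G_β)` then the
same identity holds for the hyperoctahedral average `Ψ̄` (the identity is linear in `Ψ` and
covariant under the symmetries of `G_β` and `D`). [folklore] -/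
theorem zdSymmetrize_identity (hβ : 0 ≤ β) {Ψ : Site d → ℝ} (hΨ : Summable fun u => |Ψ u|)
    (hid : ∀ x, spreadOutTwoPoint d L β x = Ψ x + isingZ d L β *
      latticeConv (soStep d L) (latticeConv Ψ (spreadOutTwoPoint d L β)) x) (x : Site d) :
    spreadOutTwoPoint d L β x = zdSymmetrize Ψ x + isingZ d L β *
      latticeConv (soStep d L) (latticeConv (zdSymmetrize Ψ) (spreadOutTwoPoint d L β)) x := by
  set G := spreadOutTwoPoint d L β with hGdef
  have hG : IsZdSymmetric G := isZdSymmetric_spreadOutTwoPoint β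
  have hG1 : ∀ y, |G y| ≤ 1 := fun y =>
    abs_le.2 ⟨by linarith [spreadOutTwoPoint_nonneg (d := d) (L := L) hβ y],
      spreadOutTwoPoint_le_one β y⟩
  set N : ℝ := (Fintype.card (HOData d) : ℝ) with hN
  have hN0 : N ≠ 0 := by rw [hN]; positivity
  -- the identity for each `Ψ ∘ σ_g`, evaluated at `x`
  have hg : ∀ g : HOData d, G x = Ψ (Site.signedPerm g.1 g.2 x) + isingZ d L β *
      latticeConv (soStep d L) (latticeConv (fun u => Ψ (Site.signedPerm g.1 g.2 u)) G) x := by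
    intro g
    rw [latticeConv_comp_signedPerm hG, ← hid, hG g.1 g.2 x]
  -- linearity of the convolution term in `Ψ`
  have hlin : latticeConv (soStep d L) (latticeConv (zdSymmetrize Ψ) G) x =
      N⁻¹ * ∑ g : HOData d,
        latticeConv (soStep d L) (latticeConv (fun u => Ψ (Site.signedPerm g.1 g.2 u)) G) x := by
    simp only [latticeConv_soStep_eq_sum, Finset.mul_sum]
    rw [Finset.sum_comm]
    refine Finset.sum_congr rfl fun w _ => ?_
    have hsum : ∀ g : HOData d, Summable fun u => Ψ (Site.signedPerm g.1 g.2 u) * G (x - w - u) :=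
      fun g => summable_mul_sub_of_abs_le_one
        ((Equiv.summable_iff (Site.signedPerm g.1 g.2) (f := fun u => |Ψ u|)).2 hΨ) hG1 _
    unfold latticeConv zdSymmetrize
    calc soStep d L w * ∑' u, (N⁻¹ * ∑ g : HOData d, Ψ (Site.signedPerm g.1 g.2 u)) * G (x - w - u)
        = soStep d L w * ∑' u, ∑ g : HOData d, N⁻¹ * (Ψ (Site.signedPerm g.1 g.2 u) * G (x - w - u)) := by
          congr 1
          refine tsum_congr fun u => ?_
          rw [Finset.mul_sum, Finset.sum_mul]
          refine Finset.sum_congr rfl fun g _ => ?_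
          ring
      _ = soStep d L w * ∑ g : HOData d, N⁻¹ * ∑' u, Ψ (Site.signedPerm g.1 g.2 u) * G (x - w - u) := by
          rw [Summable.tsum_finsetSum fun g _ => (hsum g).mul_left _]
          congr 1
          refine Finset.sum_congr rfl fun g _ => ?_
          exact tsum_mul_left
      _ = ∑ g : HOData d, N⁻¹ * (soStep d L w * ∑' u, Ψ (Site.signedPerm g.1 g.2 u) * G (x - w - u)) := by
          rw [Finset.mul_sum]
          refine Finset.sum_congr rfl fun g _ => ?_
          ring
  -- average the identities
  have havg : G x = N⁻¹ * ∑ g : HOData d, (Ψ (Site.signedPerm g.1 g.2 x) + isingZ d L β *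
      latticeConv (soStep d L) (latticeConv (fun u => Ψ (Site.signedPerm g.1 g.2 u)) G) x) := by
    rw [Finset.sum_congr rfl fun g _ => (hg g).symm, Finset.sum_const, Finset.card_univ,
      nsmul_eq_mul, ← mul_assoc, ← hN, inv_mul_cancel₀ hN0, one_mul]
  rw [hlin, havg, zdSymmetrize, ← hN, Finset.sum_add_distrib, mul_add, ← Finset.mul_sum]
  ring

end Symmetrise


/-! ## Part 4. Assembly: `Sakai2007_laceExpansionBounds → Sakai2007_isingAssumptionH` -/

section Assembly

/-- The decay profile is `ℤ^d`-symmetric. [folklore] -/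
theorem isZdSymmetric_decay3 : IsZdSymmetric (decay3 d) := fun π ε x => by
  rw [decay3, decay3, jnorm_signedPerm]

/-- `⟦x⟧^{-3(d-2)} = 1/⟦x⟧^{d+2+ρ}` with `ρ = 2(d-4)`. [cite: Sakai2007, (3.6) (ρ = 2(d-4))] -/
theorem decay3_eq_inv_rpow (x : Site d) :
    decay3 d x = (jnorm x ^ ((d : ℝ) + 2 + 2 * ((d : ℝ) - 4)))⁻¹ := by
  rw [decay3, ← Real.rpow_neg (jnorm_pos x).le]
  congr 1
  ring

variable {β C θ₀ : ℝ}

/-- **From the finite-volume fact at one `(L, β, θ₀)` to the infinite-volume expansion**: if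
every box carries a lace expansion obeying (3.3) with `Cθ₀ ≤ 1/2`, `θ₀ ≤ 1`, `τ ≤ 2`, then there is
a `ℤ^d`-symmetric `h` with `G_β = h + τ D * (h * G_β)` and
`|h(x) - δ_{0,x}| ≤ Cθ₀ δ_{0,x} + (4C + 8C²)θ₀²⟦x⟧^{-3(d-2)}` — Sakai's (1.18) for the spread-out
model, in Liu–Slade's form. [cite: Sakai2007, §1.2 (1.18) and §3.1 (3.4)–(3.6)] -/
theorem exists_symmetric_expansion (hd : 4 < d) (hL : 1 ≤ L) (hβ : 0 ≤ β)
    (hτ : isingZ d L β ≤ 2) (hC : 0 < C) (hθ : 0 < θ₀) (hθ1 : θ₀ ≤ 1) (hr : C * θ₀ ≤ 1 / 2)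
    (H : ∀ n : ℕ, ∃ π R : ℕ → Site d → ℝ, IsLaceExpansion d L β n π R ∧ LaceCoeffBounds d C θ₀ n π) :
    ∃ h : Site d → ℝ, IsZdSymmetric h ∧
      (∀ x, spreadOutTwoPoint d L β x = h x + isingZ d L β *
        latticeConv (soStep d L) (latticeConv h (spreadOutTwoPoint d L β)) x) ∧
      ∀ x, |h x - delta0 x| ≤ C * θ₀ * delta0 x + (4 * C + 8 * C ^ 2) * θ₀ ^ 2 * decay3 d x := by
  have hd1 : 1 ≤ d := by omega
  choose π R hE hB using H
  -- the finite-volume sums `Φ_n = Π_{Λ_n}` and their uniform bounds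
  set Φ : ℕ → Site d → ℝ := fun n => lacePiLim d n (π n) with hΦ
  set b : Site d → ℝ := fun x => C * θ₀ * delta0 x + (4 * C + 8 * C ^ 2) * θ₀ ^ 2 * decay3 d x
    with hb
  set B : Site d → ℝ := fun x => (1 + C) * delta0 x + (4 * C + 8 * C ^ 2) * decay3 d x with hBdef
  have hbB : ∀ x, delta0 x + b x ≤ B x := fun x => by
    have hδ := delta0_nonneg x
    have hJ := (decay3_pos (d := d) x).le
    have h1 : C * θ₀ * delta0 x ≤ C * delta0 x := by
      calc C * θ₀ * delta0 x = θ₀ * (C * delta0 x) := by ring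
        _ ≤ 1 * (C * delta0 x) := mul_le_mul_of_nonneg_right hθ1 (by positivity)
        _ = C * delta0 x := one_mul _
    have h2 : (4 * C + 8 * C ^ 2) * θ₀ ^ 2 * decay3 d x ≤ (4 * C + 8 * C ^ 2) * decay3 d x := by
      have : θ₀ ^ 2 ≤ 1 := by nlinarith
      have h0 : 0 ≤ (4 * C + 8 * C ^ 2) * decay3 d x := by positivity
      nlinarith
    rw [hb, hBdef]; linarith
  have hbound : ∀ n, ∀ x ∈ box d n, |Φ n x - delta0 x| ≤ b x := fun n x hx =>
    abs_lacePiLim_sub_delta0_le (hE n) (hB n) hC.le hθ.le hθ1 hr hx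
  have hseq : IsBoxExpansionSeq d L β Φ B := by
    refine ⟨?_, fun n x => ?_, fun n x hx => lacePiLim_of_not_mem hx, fun n x hx => ?_⟩
    · -- `B` is summable (`3(d-2) > d`)
      have hs : Summable (decay3 d) := summable_jnorm_rpow_neg (by
        have : (4 : ℝ) < d := by exact_mod_cast hd
        linarith)
      exact ((hasSum_ite_eq (0 : Site d) (1 + C)).summable.congr fun x => by
        unfold delta0; split_ifs <;> simp).add (hs.mul_left _)
    · by_cases hx : x ∈ box d n
      · have h := hbound n x hx
        have : |Φ n x| ≤ |Φ n x - delta0 x| + delta0 x := by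
          have := abs_add_le (Φ n x - delta0 x) (delta0 x)
          rwa [sub_add_cancel, abs_of_nonneg (delta0_nonneg x)] at this
        linarith [hbB x]
      · rw [show Φ n x = 0 from lacePiLim_of_not_mem hx, abs_zero]
        have := hbB x
        have hδ := delta0_nonneg x
        have : 0 ≤ b x := by rw [hb]; have := (decay3_pos (d := d) x).le; positivity
        linarith
    · exact boxTwoPoint_eq_lacePiLim_add (hE n) (hB n) hβ hτ hC.le hθ.le hθ1 hr hx
  -- the infinite-volume limit, the convolution algebra, the symmetrisation
  obtain ⟨Ψ, hΨB, hΨb, hΨid⟩ := hseq.exists_limit hd1 hL hβ hbound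
  have hΨsum : Summable fun u => |Ψ u| :=
    Summable.of_nonneg_of_le (fun u => abs_nonneg _) hΨB hseq.summable
  have hG1 : ∀ y, |spreadOutTwoPoint d L β y| ≤ 1 := fun y =>
    abs_le.2 ⟨by linarith [spreadOutTwoPoint_nonneg (d := d) (L := L) hβ y],
      spreadOutTwoPoint_le_one β y⟩
  have hΨid' : ∀ x, spreadOutTwoPoint d L β x = Ψ x + isingZ d L β *
      latticeConv (soStep d L) (latticeConv Ψ (spreadOutTwoPoint d L β)) x := fun x => by
    rw [← latticeConv_latticeConv_soStep_comm hΨsum hG1]; exact hΨid x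
  refine ⟨zdSymmetrize Ψ, isZdSymmetric_zdSymmetrize Ψ, zdSymmetrize_identity hβ hΨsum hΨid',
    fun x => ?_⟩
  have hbsymm : IsZdSymmetric b := fun π' ε x => by
    simp only [hb, isZdSymmetric_delta0 π' ε x, isZdSymmetric_decay3 π' ε x]
  exact abs_zdSymmetrize_sub_le isZdSymmetric_delta0 hbsymm hΨb x

/-- `θ(L) = 3K_S L^{-(2-ε)} → 0` as `L → ∞` (`ε < 2`). [folklore] -/
theorem tendsto_threeKS_rpow {K_S ε : ℝ} (hε : ε < 2) :
    Tendsto (fun L : ℕ => 3 * K_S * (L : ℝ) ^ (-(2 - ε))) atTop (𝓝 0) := by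
  have h := ((tendsto_rpow_neg_atTop (by linarith : (0 : ℝ) < 2 - ε)).comp
    tendsto_natCast_atTop_atTop).const_mul (3 * K_S)
  rw [mul_zero] at h
  exact h

/-- **Sakai 2007, Propositions 1.1 and 3.1 imply Liu–Slade's Assumption 1.5 for the spread-out
Ising model in `d > 4` with `ρ = 2(d-4)`** — the assembly of `Sakai2007_isingAssumptionH`
along the printed route (§3.1, sketch proof of Prop. 1.2, and §1.2, (1.18)): given `ε ∈ (0, 1]`
and `K_S > 0`, put `θ₀ = 3K_S L^{-2+ε}` (so that `b(z) ≤ 3` is the hypothesis (3.2) with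
`q = d - 2`, and `θ₀L² = 3K_S L^ε ≥ 3K_S`), `K_h = 3CK_S` (so `K_h L^{-2+ε} = Cθ₀`) and
`η_L = (4C + 8C²)θ₀/C = O(L^{-2+ε}) → 0` (so `K_h L^{-2+ε} η_L = (4C+8C²)θ₀²`); for `L` large
(`θ₀ ≤ θ₁ ∧ 1 ∧ 1/(2C)`) and `z ∈ [1, z_c]` with `b(z) ≤ 3`, at `β = β(z)` (`τ = z ≤ 2`) the boxes
carry lace expansions obeying (3.3), whence (`exists_symmetric_expansion`) a symmetric `h` with
`G_z = h + zD * (h * G_z)` and `|h(x) - δ_{0,x}| ≤ K_h L^{-2+ε}(δ_{0,x} + η_L ⟦x⟧^{-(d+2+ρ)})`,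
`d + 2 + ρ = 3(d-2)`. [cite: Sakai2007, Proposition 1.2 (sketch proof, §3.1) and (1.18)]
[cite: LiuSlade2026, Assumption 1.5 and §1.2.2 ((1.22)–(1.23))] -/
theorem Sakai2007_isingAssumptionH_of_laceExpansionBounds (hF : Sakai2007_laceExpansionBounds) :
    Sakai2007_isingAssumptionH := by
  intro d hd
  refine ⟨1, one_pos, fun ε hε hε1 K_S hKS => ?_⟩
  have hd1 : 1 ≤ d := by omega
  obtain ⟨θ₁, hθ₁, C, hC, L₀', hL₀', H⟩ := hF d hd (3 * K_S) (by positivity)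
  -- the constants
  set θ : ℕ → ℝ := fun L => 3 * K_S * (L : ℝ) ^ (-(2 - ε)) with hθ
  set η : ℕ → ℝ := fun L => (4 * C + 8 * C ^ 2) * θ L / C with hη
  have hηlim : Tendsto η atTop (𝓝 0) := by
    have h := (tendsto_threeKS_rpow (K_S := K_S) (by linarith : ε < 2)).const_mul ((4 * C + 8 * C ^ 2) / C)
    rw [mul_zero] at h
    refine h.congr fun L => ?_
    rw [hη, hθ]; ring
  -- `L₁`: `θ(L) ≤ θ₁ ∧ 1 ∧ 1/(2C)` for `L ≥ L₁`
  set m : ℝ := min θ₁ (min 1 (1 / (2 * C))) with hm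
  have hm0 : 0 < m := lt_min hθ₁ (lt_min one_pos (by positivity))
  have hev : ∀ᶠ L : ℕ in atTop, θ L ≤ m :=
    (tendsto_threeKS_rpow (K_S := K_S) (by linarith : ε < 2)).eventually (eventually_le_nhds hm0)
  obtain ⟨L₀, hL₀⟩ := Filter.eventually_atTop.1 hev
  refine ⟨3 * K_S * C, η, hηlim, max L₀ L₀', fun L hL => ?_⟩
  have hLL₀ : L₀ ≤ L := le_of_max_le_left hL
  have hLL₀' : L₀' ≤ L := le_of_max_le_right hL
  have hL1 : 1 ≤ L := hL₀'.trans hLL₀'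
  have hLpos : (0 : ℝ) < L := by exact_mod_cast hL1
  have hθm := hL₀ L hLL₀
  have hθθ₁ : θ L ≤ θ₁ := hθm.trans (min_le_left _ _)
  have hθ1 : θ L ≤ 1 := hθm.trans ((min_le_right _ _).trans (min_le_left _ _))
  have hθC : C * θ L ≤ 1 / 2 := by
    have h := hθm.trans ((min_le_right _ _).trans (min_le_right _ _))
    calc C * θ L ≤ C * (1 / (2 * C)) := mul_le_mul_of_nonneg_left h hC.le
      _ = 1 / 2 := by field_simp
  have hθpos : 0 < θ L := by rw [hθ]; positivity
  have hθL2 : 3 * K_S ≤ θ L * (L : ℝ) ^ 2 := by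
    rw [hθ]
    have h1 : (L : ℝ) ^ (-(2 - ε)) * (L : ℝ) ^ 2 = (L : ℝ) ^ ε := by
      rw [← Real.rpow_natCast, ← Real.rpow_add hLpos]
      norm_num
    have h2 : 1 ≤ (L : ℝ) ^ ε := Real.one_le_rpow (by exact_mod_cast hL1) hε.le
    calc 3 * K_S = 3 * K_S * 1 := (mul_one _).symm
      _ ≤ 3 * K_S * (L : ℝ) ^ ε := mul_le_mul_of_nonneg_left h2 (by positivity)
      _ = 3 * K_S * (L : ℝ) ^ (-(2 - ε)) * (L : ℝ) ^ 2 := by rw [← h1]; ring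
  intro z hz hboot
  -- `β = β(z)`, `τ = z ≤ 2`
  set β : ℝ := soBetaOfZ d L z with hβdef
  have hz0 : 0 ≤ z := zero_le_one.trans hz.1
  have hzN : z < soCount d L := lt_soCount_of_le_isingZc hd1 hL1 hz.2
  have hβ0 : 0 ≤ β := soBetaOfZ_nonneg hz0
  have hτ : isingZ d L β = z := isingZ_soBetaOfZ hd1 hL1 hz0 hzN
  have hz2 : z ≤ 2 := by have := hboot.2; linarith
  have hτ2 : isingZ d L β ≤ 2 := hτ.le.trans hz2
  -- the a priori bound (3.2) from `b(z) ≤ 3`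
  have hG : ∀ x : Site d, spreadOutTwoPoint d L β x ≤ delta0 x + θ L * jnorm x ^ (-((d : ℝ) - 2)) := by
    intro x
    by_cases hx : x = 0
    · subst hx
      rw [spreadOutTwoPoint_zero_right, delta0_zero, jnorm_zero, Real.one_rpow, mul_one]
      linarith
    · have h := hboot.1 x hx
      have hx1 : 1 ≤ euclidNorm x := one_le_euclidNorm_of_ne_zero hx
      rw [delta0_of_ne_zero hx, zero_add, jnorm_eq_euclidNorm hx1, hθ]
      calc spreadOutTwoPoint d L β x = isingFamily d L z x := rfl
        _ ≤ 3 * (K_S * (L : ℝ) ^ (-(2 - ε)) * euclidNorm x ^ (-((d : ℝ) - 2))) := h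
        _ = 3 * K_S * (L : ℝ) ^ (-(2 - ε)) * euclidNorm x ^ (-((d : ℝ) - 2)) := by ring
  -- Sakai's fact on every box, then the infinite-volume expansion
  have Hn := H L hLL₀' (θ L) hθpos hθθ₁ hθL2 β hβ0 hτ2 hG
  obtain ⟨h, hsymm, hid, hbd⟩ :=
    exists_symmetric_expansion hd hL1 hβ0 hτ2 hC hθpos hθ1 hθC Hn
  refine ⟨h, hsymm, fun x => ?_, fun x => ?_⟩
  · -- the identity, with `τ = z` and `G_β = G_z`
    have := hid x
    rw [hτ] at this
    exact this
  · -- the bound: `Cθ δ + (4C+8C²)θ² ⟦x⟧^{-3(d-2)} = K_h L^{-2+ε}(δ + η_L/⟦x⟧^{d+2+ρ})`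
    refine (hbd x).trans (le_of_eq ?_)
    rw [decay3_eq_inv_rpow, hη, hθ]
    field_simp

end Assembly

/-! ## Corollaries: Sakai's Theorem 1.3 and the barrier from the decomposition -/

/-- **Sakai 2007, Theorem 1.3 (spread-out) from three named facts**: Liu–Slade's Prop. 1.2
and Thm. 1.7 (the latter in its corrected transcription `LiuSlade2026_thm1_7`; pure random-walk /
Fourier analysis) and Sakai's finite-volume expansion with diagrammatic bounds
(`Sakai2007_laceExpansionBounds`); everything else — Liu–Slade's Assumption 1.3 for the model
(random-walk bound, transience, continuity, `z_c ≥ 1`, …) and the passage from the finite-volume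
expansion to Assumption 1.5 — is proved in the tree.
[cite: Sakai2007, Theorem 1.3 (SO model) and §3.1] [cite: LiuSlade2026, Theorem 1.7] -/
theorem Sakai2007_thm13_spreadOut_of_LiuSlade_laceExpansionBounds
    (h0 : LiuSlade2026_prop12_greenBound) (h1 : LiuSlade2026_thm1_7)
    (h2 : Sakai2007_laceExpansionBounds) : Sakai2007_thm13_spreadOut :=
  Sakai2007_thm13_spreadOut_of_thm1_7' h0 h1
    (Sakai2007_isingAssumptionH_of_laceExpansionBounds h2) spreadOutTwoPoint_le_soGreen_holds

end Literature.Barriers.CriticalPhenomena.SpreadOutIsing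

namespace Literature.Barriers.CriticalPhenomena

/-- **The barrier `LaceExpansionIsingAboveFour` from five named facts**, the Ising lace-expansion
input now being Sakai's finite-volume Propositions 1.1 and 3.1 (`Sakai2007_laceExpansionBounds`)
rather than the infinite-volume Assumption 1.5, and Theorem 1.7 in its corrected transcription
(as in `LaceExpansionIsingAboveFour_of_five_facts'`). [cite: Sakai2007, §1.1 and Theorem 1.3] -/
theorem LaceExpansionIsingAboveFour_of_five_facts'' (h₁ : NNIsing.bubble_susceptibility_upper)
    (h₂ : SpreadOutIsing.bubble_susceptibility_upper)
    (h₃ : SpreadOutIsing.LiuSlade2026_prop12_greenBound) (h₄ : SpreadOutIsing.LiuSlade2026_thm1_7)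
    (h₅ : SpreadOutIsing.Sakai2007_laceExpansionBounds) : LaceExpansionIsingAboveFour :=
  LaceExpansionIsingAboveFour_of_facts h₁ h₂
    (SpreadOutIsing.Sakai2007_thm13_spreadOut_of_LiuSlade_laceExpansionBounds h₃ h₄ h₅)

end Literature.Barriers.CriticalPhenomena

end
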